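import Summits.AtomisticToContinuum.BoseEinsteinCondensation.Theorems.BECRewardDescentRewardChordBoundReduction
import Summits.AtomisticToContinuum.BoseEinsteinCondensation.Theorems.BECRewardDescentRewardChordBoundSimpleNonintegrable
import Summits.AtomisticToContinuum.BoseEinsteinCondensation.Theorems.BECRewardDescentRewardChordBoundShellOfModulus

/-!
# Crux `RewardChordBound` (stmt-AtomisticToContinuum-12876) — `ShellModulus ⇐ SectorGap ∧ CondensateVariance`
# (the strategist's line `dyadic-secant` is provably NO HARDER than the registered line)

Helper file (does not close the item). The crux has two kernel-checked reductions in the tree: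
`RewardChordBound ⇐ SectorGap ∧ CondensateVariance` (line `registered`: `BECRewardDescentRewardChordBoundReduction.lean` +
the hard-core Perron–Frobenius kernel `…SimpleNonintegrable.lean`, items 12874/12875) and
`RewardChordBound ⇐ ShellModulus` (line `dyadic-secant`: `BECRewardDescentRewardChordBoundShellReduction.lean`, stub
`stub_shellModulus`). This file orders the two open inputs:

* `shellModulus_at_of_gap_of_var_of_simple` — at a FIXED repulsive finite-range `v`: the bodies of `SectorGap` and
  `CondensateVariance` at `v` and the Perron–Frobenius input at `v` give the body of `stub_shellModulus` at `v`, with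
  `η = min η₁ η₂`, `K = 5C/c`, `σ = min θ 1` (`θ` the walk scale of the registered line at `τ = η/2`) — and the shell
  inequality then holds on EVERY shell `4u ≤ σρa`, the condensation hypothesis on the upper half-shell being discharged
  by the walk itself;
* `shellModulus_of_sectorGap_of_condensateVariance` — `SectorGap → CondensateVariance → ShellModulus` for the global
  statements, unconditionally in `v` (the Perron–Frobenius input is the landed kernel
  `Birth.stub_rewardedSimpleNonintegrable` / the integrable stubs).

Proof: the landed walk at `v` (`Birth.rewardChordBound_at`, `τ = η/2`) + the PROVED rung (`rewardScaleChord_proof` at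
slope `η/4`) bound every chord slope on `(0, θρa]` by `(3η/4)N`, so (Griffiths) near-minimisers are condensed at every
reward there; then the pointwise modulus (`Birth.stub_modulusOfSimple` + the PF input + the gap/variance bodies) and no-kink
(`Birth.stub_noKinkOfSimple`) feed `ShellOfModulus.shell_of_modulus_affine` (convexity of `R + (8A/3)t^(3/2)`,
three-point inequality). Consequence for the route: promoting `ShellModulus` to the route's single thermodynamic-limit
input loses nothing — any proof of the Bogoliubov pair 12874 ∧ 12875 is a proof of it.

References: route text of BECRewardDescent; [Griffiths1966] §III; [Kato1966] VII §3; [ReedSimonIV1978] §XIII.12.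
-/

namespace Summit.AtomisticToContinuum.BoseEinsteinCondensation.Cruxes.RewardChordBound.DyadicSecant

open scoped BigOperators Topology Classical ENNReal
open Filter Set MeasureTheory
open Summit.AtomisticToContinuum.BoseEinsteinCondensation.Cruxes.RewardChordBound.Birth

/-- **The one-shell inequality at a fixed potential, from the Bogoliubov pair.** For a repulsive finite-range `v`: IF
(gap) the body of `SectorGap` holds at `v`, (var) the body of `CondensateVariance` holds at `v`, and (pf) at low density,
eventually in `N`, for every reward `s > 0` with `R(s) < ∞` the rewarded functional has a strict all-pairs Ky-Fan gap and
translation-invariant near-minimisers, THEN the body of `stub_shellModulus` holds at `v`: there are `η, K > 0`,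
`σ ∈ (0, 1]`, `ρ₀ > 0` such that for `0 < ρ < ρ₀`, eventually in `N`, every shell `(u, 4u]` with `4u ≤ σρa` satisfies
`3R(2u) ≤ 2R(u) + R(4u) + KNu√(u/(ρa))` (here even without the condensation hypothesis on the upper half-shell).
[folklore] -/
theorem shellModulus_at_of_gap_of_var_of_simple (v : ℝ → ENNReal)
    (hv : Literature.MathematicalPhysics.QuantumManyBody.BoseGas.IsRepulsiveFiniteRange v)
    (hGap : (∃ η c ρ₀ : ℝ, 0 < η ∧ 0 < c ∧ 0 < ρ₀ ∧ ∀ ρ : ℝ, 0 < ρ → ρ < ρ₀ → ∀ᶠ N : ℕ in Filter.atTop, ∀ s : ℝ, 0 < s → s ≤ ρ * (Literature.MathematicalPhysics.QuantumManyBody.BoseGas.scatteringLength v).toReal → (∃ δ : ENNReal, 0 < δ ∧ ∀ Ψ : Literature.MathematicalPhysics.QuantumManyBody.BoseGas.PeriodicTrialState N (Literature.MathematicalPhysics.QuantumManyBody.BoseGas.sideLength ρ N), (Literature.MathematicalPhysics.QuantumManyBody.BoseGas.periodicEnergy v Ψ + ENNReal.ofReal s * ((N : ENNReal) - Literature.MathematicalPhysics.QuantumManyBody.BoseGas.condensateOccupation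 N (Literature.MathematicalPhysics.QuantumManyBody.BoseGas.sideLength ρ N) Ψ.ψ)) ≤ (⨅ Ψ : Literature.MathematicalPhysics.QuantumManyBody.BoseGas.PeriodicTrialState N (Literature.MathematicalPhysics.QuantumManyBody.BoseGas.sideLength ρ N), (Literature.MathematicalPhysics.QuantumManyBody.BoseGas.periodicEnergy v Ψ + ENNReal.ofReal s * ((N : ENNReal) - Literature.MathematicalPhysics.QuantumManyBody.BoseGas.condensateOccupation N (Literature.MathematicalPhysics.QuantumManyBody.BoseGas.sideLength ρ N) Ψ.ψ))) + δ → ENNReal.ofReal ((1 - η) * N) ≤ Literature.MathematicalPhysics.QuantumManyBody.BoseGas.condensateOccupation N (Literature.MathematicalPhysics.QuantumManyBody.BoseGas.sideLength ρ N) Ψ.ψ) → (∀ Φ₁ Φ₂ : Literature.MathematicalPhysics.QuantumManyBody.BoseGas.PeriodicTrialState N (Literature.MathematicalPhysics.QuantumManyBody.BoseGas.sideLength ρ N), (∀ (X : Literature.MathematicalPhysics.QuantumManyBody.BoseGas.Config N) (t : EuclideanSpace ℝ (Fin 3)), Φ₁.ψ (fun i => X i + t) = Φ₁.ψ X) → (∀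 (X : Literature.MathematicalPhysics.QuantumManyBody.BoseGas.Config N) (t : EuclideanSpace ℝ (Fin 3)), Φ₂.ψ (fun i => X i + t) = Φ₂.ψ X) → (∫ X in Literature.MathematicalPhysics.QuantumManyBody.BoseGas.cellN N (Literature.MathematicalPhysics.QuantumManyBody.BoseGas.sideLength ρ N), starRingEnd ℂ (Φ₁.ψ X) * Φ₂.ψ X) = 0 → 2 * (⨅ Ψ : Literature.MathematicalPhysics.QuantumManyBody.BoseGas.PeriodicTrialState N (Literature.MathematicalPhysics.QuantumManyBody.BoseGas.sideLength ρ N), (Literature.MathematicalPhysics.QuantumManyBody.BoseGas.periodicEnergy v Ψ + ENNReal.ofReal s * ((N : ENNReal) - Literature.MathematicalPhysics.QuantumManyBody.BoseGas.condensateOccupation N (Literature.MathematicalPhysics.QuantumManyBody.BoseGas.sideLength ρ N) Ψ.ψ))) + ENNReal.ofReal (c * Real.sqrt (ρ * (Literature.MathematicalPhysics.QuantumManyBody.BoseGas.scatteringLength v).toReal) * Real.sqrt s) ≤ (Literature.MathematicalPhysics.QuantumManyBody.BoseGas.periodicEnergy v Φ₁ + ENNReal.ofReal s * ((N : ENNReal)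 - Literature.MathematicalPhysics.QuantumManyBody.BoseGas.condensateOccupation N (Literature.MathematicalPhysics.QuantumManyBody.BoseGas.sideLength ρ N) Φ₁.ψ)) + (Literature.MathematicalPhysics.QuantumManyBody.BoseGas.periodicEnergy v Φ₂ + ENNReal.ofReal s * ((N : ENNReal) - Literature.MathematicalPhysics.QuantumManyBody.BoseGas.condensateOccupation N (Literature.MathematicalPhysics.QuantumManyBody.BoseGas.sideLength ρ N) Φ₂.ψ)))))
    (hVar : (∃ η C ρ₀ : ℝ, 0 < η ∧ 0 < C ∧ 0 < ρ₀ ∧ ∀ ρ : ℝ, 0 < ρ → ρ < ρ₀ → ∀ᶠ N : ℕ in Filter.atTop, ∀ s : ℝ, 0 < s → s ≤ ρ * (Literature.MathematicalPhysics.QuantumManyBody.BoseGas.scatteringLength v).toReal → (∃ δ : ENNReal, 0 < δ ∧ ∀ Ψ : Literature.MathematicalPhysics.QuantumManyBody.BoseGas.PeriodicTrialState N (Literature.MathematicalPhysics.QuantumManyBody.BoseGas.sideLength ρ N), (Literature.MathematicalPhysics.QuantumManyBody.BoseGas.periodicEnergy v Ψ + ENNReal.ofReal s * ((N : ENNReal)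 - Literature.MathematicalPhysics.QuantumManyBody.BoseGas.condensateOccupation N (Literature.MathematicalPhysics.QuantumManyBody.BoseGas.sideLength ρ N) Ψ.ψ)) ≤ (⨅ Ψ : Literature.MathematicalPhysics.QuantumManyBody.BoseGas.PeriodicTrialState N (Literature.MathematicalPhysics.QuantumManyBody.BoseGas.sideLength ρ N), (Literature.MathematicalPhysics.QuantumManyBody.BoseGas.periodicEnergy v Ψ + ENNReal.ofReal s * ((N : ENNReal) - Literature.MathematicalPhysics.QuantumManyBody.BoseGas.condensateOccupation N (Literature.MathematicalPhysics.QuantumManyBody.BoseGas.sideLength ρ N) Ψ.ψ))) + δ → ENNReal.ofReal ((1 - η) * N) ≤ Literature.MathematicalPhysics.QuantumManyBody.BoseGas.condensateOccupation N (Literature.MathematicalPhysics.QuantumManyBody.BoseGas.sideLength ρ N) Ψ.ψ) → (∃ δ : ENNReal, 0 < δ ∧ ∀ Ψ : Literature.MathematicalPhysics.QuantumManyBody.BoseGas.PeriodicTrialState N (Literature.MathematicalPhysics.QuantumManyBody.BoseGas.sideLength ρ N), (Literature.MathematicalPhysics.QuantumManyBody.BoseGas.periodicEnergy v Ψ + ENNReal.ofReal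 s * ((N : ENNReal) - Literature.MathematicalPhysics.QuantumManyBody.BoseGas.condensateOccupation N (Literature.MathematicalPhysics.QuantumManyBody.BoseGas.sideLength ρ N) Ψ.ψ)) ≤ (⨅ Ψ : Literature.MathematicalPhysics.QuantumManyBody.BoseGas.PeriodicTrialState N (Literature.MathematicalPhysics.QuantumManyBody.BoseGas.sideLength ρ N), (Literature.MathematicalPhysics.QuantumManyBody.BoseGas.periodicEnergy v Ψ + ENNReal.ofReal s * ((N : ENNReal) - Literature.MathematicalPhysics.QuantumManyBody.BoseGas.condensateOccupation N (Literature.MathematicalPhysics.QuantumManyBody.BoseGas.sideLength ρ N) Ψ.ψ))) + δ → ENNReal.ofReal (((Literature.MathematicalPhysics.QuantumManyBody.BoseGas.sideLength ρ N) ^ 3)⁻¹ ^ 2) * (∫⁻ X in Literature.MathematicalPhysics.QuantumManyBody.BoseGas.cellN N (Literature.MathematicalPhysics.QuantumManyBody.BoseGas.sideLength ρ N), (‖∑ i : Fin N, ∫ y in Literature.MathematicalPhysics.QuantumManyBody.BoseGas.cell (Literature.MathematicalPhysics.QuantumManyBody.BoseGas.sideLength ρ N), Ψ.ψ (Function.update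 X i y)‖₊ : ENNReal) ^ 2) ≤ Literature.MathematicalPhysics.QuantumManyBody.BoseGas.condensateOccupation N (Literature.MathematicalPhysics.QuantumManyBody.BoseGas.sideLength ρ N) Ψ.ψ ^ 2 + ENNReal.ofReal (C * N))))
    (hSimple : (∃ ρ₅ : ℝ, 0 < ρ₅ ∧ ∀ ρ : ℝ, 0 < ρ → ρ < ρ₅ → ∀ᶠ N : ℕ in Filter.atTop, ∀ s : ℝ, 0 < s → (⨅ Ψ : Literature.MathematicalPhysics.QuantumManyBody.BoseGas.PeriodicTrialState N (Literature.MathematicalPhysics.QuantumManyBody.BoseGas.sideLength ρ N), (Literature.MathematicalPhysics.QuantumManyBody.BoseGas.periodicEnergy v Ψ + ENNReal.ofReal s * ((N : ENNReal) - Literature.MathematicalPhysics.QuantumManyBody.BoseGas.condensateOccupation N (Literature.MathematicalPhysics.QuantumManyBody.BoseGas.sideLength ρ N) Ψ.ψ))) ≠ ⊤ → (∃ g : ℝ, 0 < g ∧ (∀ Φ₁ Φ₂ : Literature.MathematicalPhysics.QuantumManyBody.BoseGas.PeriodicTrialState N (Literature.MathematicalPhysics.QuantumManyBody.BoseGas.sideLength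 ρ N), (∫ X in Literature.MathematicalPhysics.QuantumManyBody.BoseGas.cellN N (Literature.MathematicalPhysics.QuantumManyBody.BoseGas.sideLength ρ N), starRingEnd ℂ (Φ₁.ψ X) * Φ₂.ψ X) = 0 → 2 * (⨅ Ψ : Literature.MathematicalPhysics.QuantumManyBody.BoseGas.PeriodicTrialState N (Literature.MathematicalPhysics.QuantumManyBody.BoseGas.sideLength ρ N), (Literature.MathematicalPhysics.QuantumManyBody.BoseGas.periodicEnergy v Ψ + ENNReal.ofReal s * ((N : ENNReal) - Literature.MathematicalPhysics.QuantumManyBody.BoseGas.condensateOccupation N (Literature.MathematicalPhysics.QuantumManyBody.BoseGas.sideLength ρ N) Ψ.ψ))) + ENNReal.ofReal g ≤ (Literature.MathematicalPhysics.QuantumManyBody.BoseGas.periodicEnergy v Φ₁ + ENNReal.ofReal s * ((N : ENNReal) - Literature.MathematicalPhysics.QuantumManyBody.BoseGas.condensateOccupation N (Literature.MathematicalPhysics.QuantumManyBody.BoseGas.sideLength ρ N) Φ₁.ψ)) + (Literature.MathematicalPhysics.QuantumManyBody.BoseGas.periodicEnergy v Φ₂ + ENNReal.ofReal s * ((N :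 ENNReal) - Literature.MathematicalPhysics.QuantumManyBody.BoseGas.condensateOccupation N (Literature.MathematicalPhysics.QuantumManyBody.BoseGas.sideLength ρ N) Φ₂.ψ)))) ∧ (∀ δ : ENNReal, 0 < δ → ∃ Ψ : Literature.MathematicalPhysics.QuantumManyBody.BoseGas.PeriodicTrialState N (Literature.MathematicalPhysics.QuantumManyBody.BoseGas.sideLength ρ N), (∀ (X : Literature.MathematicalPhysics.QuantumManyBody.BoseGas.Config N) (t : EuclideanSpace ℝ (Fin 3)), Ψ.ψ (fun i => X i + t) = Ψ.ψ X) ∧ (Literature.MathematicalPhysics.QuantumManyBody.BoseGas.periodicEnergy v Ψ + ENNReal.ofReal s * ((N : ENNReal) - Literature.MathematicalPhysics.QuantumManyBody.BoseGas.condensateOccupation N (Literature.MathematicalPhysics.QuantumManyBody.BoseGas.sideLength ρ N) Ψ.ψ)) ≤ (⨅ Ψ : Literature.MathematicalPhysics.QuantumManyBody.BoseGas.PeriodicTrialState N (Literature.MathematicalPhysics.QuantumManyBody.BoseGas.sideLength ρ N), (Literature.MathematicalPhysics.QuantumManyBody.BoseGas.periodicEnergy v Ψ + ENNReal.ofReal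 s * ((N : ENNReal) - Literature.MathematicalPhysics.QuantumManyBody.BoseGas.condensateOccupation N (Literature.MathematicalPhysics.QuantumManyBody.BoseGas.sideLength ρ N) Ψ.ψ))) + δ))) :
    ∃ η K σ ρ₀ : ℝ, 0 < η ∧ 0 < K ∧ 0 < σ ∧ σ ≤ 1 ∧ 0 < ρ₀ ∧ ∀ ρ : ℝ, 0 < ρ → ρ < ρ₀ → ∀ᶠ N : ℕ in Filter.atTop,
        ∀ u : ℝ, 0 < u → 4 * u ≤ σ * ρ * (Literature.MathematicalPhysics.QuantumManyBody.BoseGas.scatteringLength v).toReal →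
          (∀ w : ℝ, 2 * u < w → w ≤ 4 * u → ∃ δ : ENNReal, 0 < δ ∧
            ∀ Ψ : Literature.MathematicalPhysics.QuantumManyBody.BoseGas.PeriodicTrialState N
              (Literature.MathematicalPhysics.QuantumManyBody.BoseGas.sideLength ρ N),
              Literature.MathematicalPhysics.QuantumManyBody.BoseGas.periodicEnergy v Ψ + ENNReal.ofReal w *
                  ((N : ENNReal) - Literature.MathematicalPhysics.QuantumManyBody.BoseGas.condensateOccupation N
                    (Literature.MathematicalPhysics.QuantumManyBody.BoseGas.sideLength ρ N) Ψ.ψ) ≤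
                (⨅ Ψ' : Literature.MathematicalPhysics.QuantumManyBody.BoseGas.PeriodicTrialState N
                  (Literature.MathematicalPhysics.QuantumManyBody.BoseGas.sideLength ρ N),
                  (Literature.MathematicalPhysics.QuantumManyBody.BoseGas.periodicEnergy v Ψ' + ENNReal.ofReal w *
                    ((N : ENNReal) - Literature.MathematicalPhysics.QuantumManyBody.BoseGas.condensateOccupation N
                      (Literature.MathematicalPhysics.QuantumManyBody.BoseGas.sideLength ρ N) Ψ'.ψ))) + δ →
              ENNReal.ofReal ((1 - η) * N) ≤
                Literature.MathematicalPhysics.QuantumManyBody.BoseGas.condensateOccupation N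
                  (Literature.MathematicalPhysics.QuantumManyBody.BoseGas.sideLength ρ N) Ψ.ψ) →
          3 * (⨅ Ψ : Literature.MathematicalPhysics.QuantumManyBody.BoseGas.PeriodicTrialState N
              (Literature.MathematicalPhysics.QuantumManyBody.BoseGas.sideLength ρ N),
              (Literature.MathematicalPhysics.QuantumManyBody.BoseGas.periodicEnergy v Ψ + ENNReal.ofReal (2 * u) *
                ((N : ENNReal) - Literature.MathematicalPhysics.QuantumManyBody.BoseGas.condensateOccupation N
                  (Literature.MathematicalPhysics.QuantumManyBody.BoseGas.sideLength ρ N) Ψ.ψ))) ≤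
            2 * (⨅ Ψ : Literature.MathematicalPhysics.QuantumManyBody.BoseGas.PeriodicTrialState N
                (Literature.MathematicalPhysics.QuantumManyBody.BoseGas.sideLength ρ N),
                (Literature.MathematicalPhysics.QuantumManyBody.BoseGas.periodicEnergy v Ψ + ENNReal.ofReal u *
                  ((N : ENNReal) - Literature.MathematicalPhysics.QuantumManyBody.BoseGas.condensateOccupation N
                    (Literature.MathematicalPhysics.QuantumManyBody.BoseGas.sideLength ρ N) Ψ.ψ))) +
              (⨅ Ψ : Literature.MathematicalPhysics.QuantumManyBody.BoseGas.PeriodicTrialState N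
                (Literature.MathematicalPhysics.QuantumManyBody.BoseGas.sideLength ρ N),
                (Literature.MathematicalPhysics.QuantumManyBody.BoseGas.periodicEnergy v Ψ + ENNReal.ofReal (4 * u) *
                  ((N : ENNReal) - Literature.MathematicalPhysics.QuantumManyBody.BoseGas.condensateOccupation N
                    (Literature.MathematicalPhysics.QuantumManyBody.BoseGas.sideLength ρ N) Ψ.ψ))) +
              ENNReal.ofReal (K * N * u * Real.sqrt (u / (ρ *
                (Literature.MathematicalPhysics.QuantumManyBody.BoseGas.scatteringLength v).toReal))) := by
  have hKink := stub_noKinkOfSimple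
  have hMod := stub_modulusOfSimple
  obtain ⟨η₁, c, ρ₁, hη₁, hc, hρ₁, hG⟩ := hGap
  obtain ⟨η₂, C, ρ₂, hη₂, hC, hρ₂, hV⟩ := hVar
  have hη : 0 < min η₁ η₂ := lt_min hη₁ hη₂
  -- the chord bound at `v` with `τ = η/2`, from the landed walk of the registered line
  obtain ⟨θ, ρ₆, hθ, hρ₆, hCB⟩ := rewardChordBound_at v hv (min η₁ η₂ / 2) (by positivity)
    ⟨η₁, c, ρ₁, hη₁, hc, hρ₁, hG⟩ ⟨η₂, C, ρ₂, hη₂, hC, hρ₂, hV⟩ hSimple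
  obtain ⟨ρ₃, hρ₃, hR1⟩ :=
    Summit.AtomisticToContinuum.BoseEinsteinCondensation.Theorems.rewardScaleChord_proof v hv (min η₁ η₂ / 4) θ
      (by positivity) hθ
  obtain ⟨ρ₄, hρ₄, hFin⟩ :=
    Summit.AtomisticToContinuum.BoseEinsteinCondensation.Theses.BECRewardDescent.PeriodicEnergyFinite_holds v hv
  obtain ⟨ρ₅, hρ₅, hS⟩ := hSimple
  refine ⟨min η₁ η₂, 5 * C / c, min θ 1, min ρ₁ (min ρ₂ (min ρ₃ (min ρ₄ (min ρ₅ ρ₆)))), hη, by positivity,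
    lt_min hθ one_pos, min_le_right _ _, lt_min hρ₁ (lt_min hρ₂ (lt_min hρ₃ (lt_min hρ₄ (lt_min hρ₅ hρ₆)))),
    fun ρ hρ hρlt => ?_⟩
  have h1 : ρ < ρ₁ := lt_of_lt_of_le hρlt (min_le_left _ _)
  have h2 : ρ < ρ₂ := lt_of_lt_of_le hρlt ((min_le_right _ _).trans (min_le_left _ _))
  have h3 : ρ < ρ₃ :=
    lt_of_lt_of_le hρlt ((min_le_right _ _).trans ((min_le_right _ _).trans (min_le_left _ _)))
  have h4 : ρ < ρ₄ := lt_of_lt_of_le hρlt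
    ((min_le_right _ _).trans ((min_le_right _ _).trans ((min_le_right _ _).trans (min_le_left _ _))))
  have h5 : ρ < ρ₅ := lt_of_lt_of_le hρlt ((min_le_right _ _).trans ((min_le_right _ _).trans
    ((min_le_right _ _).trans ((min_le_right _ _).trans (min_le_left _ _)))))
  have h6 : ρ < ρ₆ := lt_of_lt_of_le hρlt ((min_le_right _ _).trans ((min_le_right _ _).trans
    ((min_le_right _ _).trans ((min_le_right _ _).trans (min_le_right _ _)))))
  have hN0 : ∀ N : ℕ, (0 : ℝ) ≤ N := fun N => N.cast_nonneg
  have hη₁' : ∀ N : ℕ, (1 - η₁) * (N : ℝ) ≤ (1 - min η₁ η₂) * N := fun N =>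
    mul_le_mul_of_nonneg_right (by linarith [min_le_left η₁ η₂]) (hN0 N)
  have hη₂' : ∀ N : ℕ, (1 - η₂) * (N : ℝ) ≤ (1 - min η₁ η₂) * N := fun N =>
    mul_le_mul_of_nonneg_right (by linarith [min_le_right η₁ η₂]) (hN0 N)
  filter_upwards [hG ρ hρ h1, hV ρ hρ h2, hR1 ρ hρ h3, hFin ρ hρ h4, hS ρ hρ h5, hCB ρ hρ h6]
    with N hGN hVN hRN hFN hSN hCBN
  intro u hu h4u _hshell
  -- every `R(t)` is finite: `R(t) ≤ E(Ψ) + tN` for a finite-energy `Ψ`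
  have hRt : ∀ t : ℝ, (⨅ Ψ : Literature.MathematicalPhysics.QuantumManyBody.BoseGas.PeriodicTrialState N (Literature.MathematicalPhysics.QuantumManyBody.BoseGas.sideLength ρ N), (Literature.MathematicalPhysics.QuantumManyBody.BoseGas.periodicEnergy v Ψ + ENNReal.ofReal t * ((N : ENNReal) - Literature.MathematicalPhysics.QuantumManyBody.BoseGas.condensateOccupation N (Literature.MathematicalPhysics.QuantumManyBody.BoseGas.sideLength ρ N) Ψ.ψ))) ≠ ⊤ := fun t =>
    Summit.AtomisticToContinuum.BoseEinsteinCondensation.Theorems.WalkGlue.iInf_affine_ne_top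
      (fun Ψ : Literature.MathematicalPhysics.QuantumManyBody.BoseGas.PeriodicTrialState N (Literature.MathematicalPhysics.QuantumManyBody.BoseGas.sideLength ρ N) => Literature.MathematicalPhysics.QuantumManyBody.BoseGas.periodicEnergy v Ψ)
      (fun Ψ : Literature.MathematicalPhysics.QuantumManyBody.BoseGas.PeriodicTrialState N (Literature.MathematicalPhysics.QuantumManyBody.BoseGas.sideLength ρ N) => ((N : ENNReal) - Literature.MathematicalPhysics.QuantumManyBody.BoseGas.condensateOccupation N (Literature.MathematicalPhysics.QuantumManyBody.BoseGas.sideLength ρ N) Ψ.ψ))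
      (M := (N : ENNReal)) (fun Ψ => tsub_le_self) (ENNReal.natCast_ne_top N) hFN t
  -- scales: `S₀ = min θ 1 · ρa ≤ s₀ = θρa`, `S₀ ≤ ρa`
  have hS₀ : 0 < min θ 1 * ρ * (Literature.MathematicalPhysics.QuantumManyBody.BoseGas.scatteringLength v).toReal := by linarith
  have hρa : 0 < ρ * (Literature.MathematicalPhysics.QuantumManyBody.BoseGas.scatteringLength v).toReal := by
    rw [mul_assoc] at hS₀
    exact pos_of_mul_pos_right hS₀ (lt_min hθ one_pos).le
  have hS₀s : min θ 1 * ρ * (Literature.MathematicalPhysics.QuantumManyBody.BoseGas.scatteringLength v).toReal ≤ θ * ρ * (Literature.MathematicalPhysics.QuantumManyBody.BoseGas.scatteringLength v).toReal := by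
    rw [mul_assoc, mul_assoc θ]
    exact mul_le_mul_of_nonneg_right (min_le_left _ _) hρa.le
  have hS₀a : min θ 1 * ρ * (Literature.MathematicalPhysics.QuantumManyBody.BoseGas.scatteringLength v).toReal ≤ ρ * (Literature.MathematicalPhysics.QuantumManyBody.BoseGas.scatteringLength v).toReal := by
    rw [mul_assoc]
    exact mul_le_of_le_one_left hρa.le (min_le_right _ _)
  have hs₀ : 0 < θ * ρ * (Literature.MathematicalPhysics.QuantumManyBody.BoseGas.scatteringLength v).toReal := hS₀.trans_le hS₀s
  refine ShellOfModulus.shell_of_modulus_affine (Literature.MathematicalPhysics.QuantumManyBody.BoseGas.PeriodicTrialState N (Literature.MathematicalPhysics.QuantumManyBody.BoseGas.sideLength ρ N))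
    (fun Ψ => Literature.MathematicalPhysics.QuantumManyBody.BoseGas.periodicEnergy v Ψ)
    (fun Ψ => (N : ℝ≥0∞) - Literature.MathematicalPhysics.QuantumManyBody.BoseGas.condensateOccupation N (Literature.MathematicalPhysics.QuantumManyBody.BoseGas.sideLength ρ N) Ψ.ψ)
    (fun Ψ => ENNReal.ofReal ((1 - min η₁ η₂) * N) ≤ Literature.MathematicalPhysics.QuantumManyBody.BoseGas.condensateOccupation N (Literature.MathematicalPhysics.QuantumManyBody.BoseGas.sideLength ρ N) Ψ.ψ)
    (fun t => ⨅ Ψ : Literature.MathematicalPhysics.QuantumManyBody.BoseGas.PeriodicTrialState N (Literature.MathematicalPhysics.QuantumManyBody.BoseGas.sideLength ρ N), (Literature.MathematicalPhysics.QuantumManyBody.BoseGas.periodicEnergy v Ψ +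
      ENNReal.ofReal t * ((N : ℝ≥0∞) - Literature.MathematicalPhysics.QuantumManyBody.BoseGas.condensateOccupation N (Literature.MathematicalPhysics.QuantumManyBody.BoseGas.sideLength ρ N) Ψ.ψ)))
    N (min η₁ η₂) c C (θ * ρ * (Literature.MathematicalPhysics.QuantumManyBody.BoseGas.scatteringLength v).toReal) (min θ 1 * ρ * (Literature.MathematicalPhysics.QuantumManyBody.BoseGas.scatteringLength v).toReal)
    ρ _ (fun _ => rfl) hη hc hC.le hS₀ hS₀s hS₀a (fun _ => tsub_le_self) hFN
    (fun Ψ h => ChordFromModulus.condensed_of_depletion_lt hη.le h)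
    (hRN _ hs₀ le_rfl) (fun s hs hss => hCBN s hs hss) ?_ ?_ u hu h4u
  · intro s hs ε hε
    exact hKink v hv N _ s hs (hRt s) (hSN s hs (hRt s)).1 ε hε
  · intro s h hh hhs hsa hlt hcond
    have hs : 0 < s := hh.trans hhs
    have hg : 0 < c * Real.sqrt (ρ * (Literature.MathematicalPhysics.QuantumManyBody.BoseGas.scatteringLength v).toReal) * Real.sqrt s :=
      lt_of_le_of_lt (by positivity) hlt
    obtain ⟨δ, hδ, hΨ⟩ := hcond
    refine hMod v hv N _ s h (c * Real.sqrt (ρ * (Literature.MathematicalPhysics.QuantumManyBody.BoseGas.scatteringLength v).toReal) * Real.sqrt s) (C * N) hh hhs hg hlt (hRt s) ?_ ?_ ?_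
    · intro t ht₁ ht₂ δ' hδ'
      have ht : 0 < t := by linarith
      exact (hSN t ht (hRt t)).2 δ' hδ'
    · intro Φ₁ Φ₂ hΦ₁ hΦ₂ horth
      exact hGN s hs hsa ⟨δ, hδ, fun Ψ hF => (ENNReal.ofReal_le_ofReal (hη₁' N)).trans (hΨ Ψ hF)⟩
        Φ₁ Φ₂ hΦ₁ hΦ₂ horth
    · exact hVN s hs hsa ⟨δ, hδ, fun Ψ hF => (ENNReal.ofReal_le_ofReal (hη₂' N)).trans (hΨ Ψ hF)⟩

/-- **`ShellModulus ⇐ SectorGap ∧ CondensateVariance` (all admissible potentials, hard cores included).** The registered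
stub `stub_shellModulus` of the crux skeleton (line `dyadic-secant`) follows from the route's two Bogoliubov cruxes BY NAME;
the Perron–Frobenius input is the landed hard-core kernel `Birth.stub_rewardedSimpleNonintegrable` for non-integrable
profiles and `Birth.stub_rewardedKyFanGapIntegrable` / `Birth.stub_rewardedZeroMomentumIntegrable` for integrable ones.
Together with `rewardChordBound_of_shellModulus` (`…ShellReduction.lean`) and `walkGlue_proof`: the two reductions of the
crux are ordered, `SectorGap ∧ CondensateVariance ⇒ ShellModulus ⇒ RewardChordBound`. [folklore] -/
theorem shellModulus_of_sectorGap_of_condensateVariance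
    (hGap : Summit.AtomisticToContinuum.BoseEinsteinCondensation.Theses.BECRewardDescent.SectorGap)
    (hVar : Summit.AtomisticToContinuum.BoseEinsteinCondensation.Theses.BECRewardDescent.CondensateVariance) :
    ∀ v : ℝ → ENNReal, Literature.MathematicalPhysics.QuantumManyBody.BoseGas.IsRepulsiveFiniteRange v →
      ∃ η K σ ρ₀ : ℝ, 0 < η ∧ 0 < K ∧ 0 < σ ∧ σ ≤ 1 ∧ 0 < ρ₀ ∧ ∀ ρ : ℝ, 0 < ρ → ρ < ρ₀ → ∀ᶠ N : ℕ in Filter.atTop,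
        ∀ u : ℝ, 0 < u → 4 * u ≤ σ * ρ * (Literature.MathematicalPhysics.QuantumManyBody.BoseGas.scatteringLength v).toReal →
          (∀ w : ℝ, 2 * u < w → w ≤ 4 * u → ∃ δ : ENNReal, 0 < δ ∧
            ∀ Ψ : Literature.MathematicalPhysics.QuantumManyBody.BoseGas.PeriodicTrialState N
              (Literature.MathematicalPhysics.QuantumManyBody.BoseGas.sideLength ρ N),
              Literature.MathematicalPhysics.QuantumManyBody.BoseGas.periodicEnergy v Ψ + ENNReal.ofReal w *
                  ((N : ENNReal) - Literature.MathematicalPhysics.QuantumManyBody.BoseGas.condensateOccupation N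
                    (Literature.MathematicalPhysics.QuantumManyBody.BoseGas.sideLength ρ N) Ψ.ψ) ≤
                (⨅ Ψ' : Literature.MathematicalPhysics.QuantumManyBody.BoseGas.PeriodicTrialState N
                  (Literature.MathematicalPhysics.QuantumManyBody.BoseGas.sideLength ρ N),
                  (Literature.MathematicalPhysics.QuantumManyBody.BoseGas.periodicEnergy v Ψ' + ENNReal.ofReal w *
                    ((N : ENNReal) - Literature.MathematicalPhysics.QuantumManyBody.BoseGas.condensateOccupation N
                      (Literature.MathematicalPhysics.QuantumManyBody.BoseGas.sideLength ρ N) Ψ'.ψ))) + δ →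
              ENNReal.ofReal ((1 - η) * N) ≤
                Literature.MathematicalPhysics.QuantumManyBody.BoseGas.condensateOccupation N
                  (Literature.MathematicalPhysics.QuantumManyBody.BoseGas.sideLength ρ N) Ψ.ψ) →
          3 * (⨅ Ψ : Literature.MathematicalPhysics.QuantumManyBody.BoseGas.PeriodicTrialState N
              (Literature.MathematicalPhysics.QuantumManyBody.BoseGas.sideLength ρ N),
              (Literature.MathematicalPhysics.QuantumManyBody.BoseGas.periodicEnergy v Ψ + ENNReal.ofReal (2 * u) *
                ((N : ENNReal) - Literature.MathematicalPhysics.QuantumManyBody.BoseGas.condensateOccupation N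
                  (Literature.MathematicalPhysics.QuantumManyBody.BoseGas.sideLength ρ N) Ψ.ψ))) ≤
            2 * (⨅ Ψ : Literature.MathematicalPhysics.QuantumManyBody.BoseGas.PeriodicTrialState N
                (Literature.MathematicalPhysics.QuantumManyBody.BoseGas.sideLength ρ N),
                (Literature.MathematicalPhysics.QuantumManyBody.BoseGas.periodicEnergy v Ψ + ENNReal.ofReal u *
                  ((N : ENNReal) - Literature.MathematicalPhysics.QuantumManyBody.BoseGas.condensateOccupation N
                    (Literature.MathematicalPhysics.QuantumManyBody.BoseGas.sideLength ρ N) Ψ.ψ))) +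
              (⨅ Ψ : Literature.MathematicalPhysics.QuantumManyBody.BoseGas.PeriodicTrialState N
                (Literature.MathematicalPhysics.QuantumManyBody.BoseGas.sideLength ρ N),
                (Literature.MathematicalPhysics.QuantumManyBody.BoseGas.periodicEnergy v Ψ + ENNReal.ofReal (4 * u) *
                  ((N : ENNReal) - Literature.MathematicalPhysics.QuantumManyBody.BoseGas.condensateOccupation N
                    (Literature.MathematicalPhysics.QuantumManyBody.BoseGas.sideLength ρ N) Ψ.ψ))) +
              ENNReal.ofReal (K * N * u * Real.sqrt (u / (ρ *
                (Literature.MathematicalPhysics.QuantumManyBody.BoseGas.scatteringLength v).toReal))) := by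
  intro v hv
  by_cases hint : (∫⁻ x : Literature.MathematicalPhysics.QuantumManyBody.BoseGas.Space, v ‖x‖) = ⊤
  · exact shellModulus_at_of_gap_of_var_of_simple v hv (hGap v hv) (hVar v hv)
      (stub_rewardedSimpleNonintegrable v hv hint)
  · refine shellModulus_at_of_gap_of_var_of_simple v hv (hGap v hv) (hVar v hv) ⟨1, one_pos, fun ρ hρ _ => ?_⟩
    filter_upwards [Filter.eventually_ge_atTop 1] with N hN s hs hRs
    have hL : 0 < Literature.MathematicalPhysics.QuantumManyBody.BoseGas.sideLength ρ N :=
      Real.rpow_pos_of_pos (div_pos (Nat.cast_pos.2 hN) hρ) _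
    exact ⟨stub_rewardedKyFanGapIntegrable v hv hint N _ s hN hL hs hRs,
      stub_rewardedZeroMomentumIntegrable v hv hint N _ s hN hL hs hRs⟩

end Summit.AtomisticToContinuum.BoseEinsteinCondensation.Cruxes.RewardChordBound.DyadicSecant
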